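import Literature.NumberTheory.Automorphic.LevelActionNormalizingHecke
import HarnessLib

/-!
# Normalising Hecke operators commute with commuting Hecke operators

Topic `NumberTheory/Automorphic`; namespace `Literature.NumberTheory.Automorphic.LevelAction`;
definitions with bodies and theorems, continuing `LevelActionNormalizingHecke`.  For `z ∈ Δ`
normalising the level `U` and `α ∈ Δ` COMMUTING with `z` (e.g. the diamond operators `⟨u⟩`,
`u` diagonal units at `p`, and the `U_p`-operators `[U diag(ϖ,1)_v U]`): on `U`-invariants
**`[U z U] [U α U] = [U zα U] = [U αz U] = [U α U] [U z U]`** (`heckeOp_normalizing_mul_apply`,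
`heckeOp_mul_normalizing_apply`, `heckeOp_comm_apply_of_normalizing`), and on cohomology
(`heckeCohomology_comm_of_normalizing`): the diamond operators preserve the `[U α U]`-ordinary parts
(`mapsTo_normalizing_ordinaryPart`) — the operator-theoretic input of the `𝒪[T(1)/T(b)]`-module
structure on ORDINARY parts ([Hida1994AIF, §2]; [KhareThorne2017, §6.3]).

## References

* H. Hida, Ann. Inst. Fourier 44 (1994), §2 (held). [Hida1994AIF]
* C. Khare, J. A. Thorne, Amer. J. Math. 139 (2017), §6.3 (arXiv:1409.7007, held). [KhareThorne2017]
-/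

noncomputable section

open CategoryTheory

namespace Literature.NumberTheory.Automorphic.LevelAction

universe u

section Abstract

variable {R : Type u} [CommRing R] {𝒢 : Type u} [Group 𝒢] {M : Type u} [AddCommGroup M]
  [Module R M] {Δ : Submonoid 𝒢} {θ : Δ →* Module.End R M} {U : Subgroup 𝒢}

/-- Right translation `gU ↦ g z U` on `𝒢 ⧸ U` by an element `z` normalising `U`. [folklore] -/
def rightTranslateQuot {z : 𝒢} (hzn : ∀ u ∈ U, z⁻¹ * u * z ∈ U) : 𝒢 ⧸ U → 𝒢 ⧸ U :=
  Quotient.map' (· * z) fun a b h => by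
    rw [QuotientGroup.leftRel_apply] at h ⊢
    have h' := hzn _ h
    rwa [show z⁻¹ * (a⁻¹ * b) * z = (a * z)⁻¹ * (b * z) by simp only [mul_inv_rev, mul_assoc]] at h'

/-- `rightTranslateQuot` on classes. [folklore] -/
@[simp]
theorem rightTranslateQuot_mk {z : 𝒢} (hzn : ∀ u ∈ U, z⁻¹ * u * z ∈ U) (g : 𝒢) :
    rightTranslateQuot hzn (g : 𝒢 ⧸ U) = ((g * z : 𝒢) : 𝒢 ⧸ U) :=
  rfl

/-- `z⁻¹` normalises when `z` does (the other way). [folklore] -/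
theorem normalizing_inv {z : 𝒢} (hzn' : ∀ u ∈ U, z * u * z⁻¹ ∈ U) (u : 𝒢) (hu : u ∈ U) :
    z⁻¹⁻¹ * u * z⁻¹ ∈ U := by
  rw [inv_inv]
  exact hzn' u hu

/-- Right translations by `z` and `z⁻¹` are inverse. [folklore] -/
theorem rightTranslateQuot_inv_apply {z : 𝒢} (hzn : ∀ u ∈ U, z⁻¹ * u * z ∈ U)
    (hzn' : ∀ u ∈ U, z * u * z⁻¹ ∈ U) (d : 𝒢 ⧸ U) :
    rightTranslateQuot (normalizing_inv hzn') (rightTranslateQuot hzn d) = d := by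
  induction d using QuotientGroup.induction_on with
  | H g => rw [rightTranslateQuot_mk, rightTranslateQuot_mk, mul_inv_cancel_right]

/-- Right translations by `z⁻¹` and `z` are inverse. [folklore] -/
theorem rightTranslateQuot_apply_inv {z : 𝒢} (hzn : ∀ u ∈ U, z⁻¹ * u * z ∈ U)
    (hzn' : ∀ u ∈ U, z * u * z⁻¹ ∈ U) (d : 𝒢 ⧸ U) :
    rightTranslateQuot hzn (rightTranslateQuot (normalizing_inv hzn') d) = d := by
  induction d using QuotientGroup.induction_on with
  | H g => rw [rightTranslateQuot_mk, rightTranslateQuot_mk, inv_mul_cancel_right]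

/-- `U (z α) U / U = z · (U α U / U)` for `z` normalising `U` (both ways). [folklore] -/
theorem doubleCosetQuot_normalizing_mul {z : 𝒢} (α : 𝒢) (hzn : ∀ u ∈ U, z⁻¹ * u * z ∈ U)
    (hzn' : ∀ u ∈ U, z * u * z⁻¹ ∈ U) :
    ArithmeticQuotient.doubleCosetQuot U (z * α) = (fun d => (z : 𝒢) • d) '' ArithmeticQuotient.doubleCosetQuot U α := by
  ext e
  constructor
  · rintro ⟨u, rfl⟩
    refine ⟨((z⁻¹ * u * z : 𝒢) : 𝒢) • (α : 𝒢 ⧸ U), ⟨⟨z⁻¹ * u * z, hzn u u.2⟩, rfl⟩, ?_⟩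
    change (z : 𝒢) • ((z⁻¹ * u * z : 𝒢) • (α : 𝒢 ⧸ U)) = (u : 𝒢) • ((z * α : 𝒢) : 𝒢 ⧸ U)
    rw [smul_smul, MulAction.Quotient.smul_coe, MulAction.Quotient.smul_coe, smul_eq_mul, smul_eq_mul]
    congr 1
    simp only [mul_assoc, mul_inv_cancel_left]
  · rintro ⟨d, ⟨u, rfl⟩, rfl⟩
    refine ⟨⟨z * u * z⁻¹, hzn' u u.2⟩, ?_⟩
    change ((z * u * z⁻¹ : 𝒢)) • ((z * α : 𝒢) : 𝒢 ⧸ U) = (z : 𝒢) • ((u : 𝒢) • (α : 𝒢 ⧸ U))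
    rw [smul_smul, MulAction.Quotient.smul_coe, MulAction.Quotient.smul_coe, smul_eq_mul, smul_eq_mul]
    congr 1
    simp only [mul_assoc, inv_mul_cancel_left]

/-- `U (α z) U / U = (U α U / U) · z` for `z` normalising `U`. [folklore] -/
theorem doubleCosetQuot_mul_normalizing {z : 𝒢} (α : 𝒢) (hzn : ∀ u ∈ U, z⁻¹ * u * z ∈ U) :
    ArithmeticQuotient.doubleCosetQuot U (α * z) = rightTranslateQuot hzn '' ArithmeticQuotient.doubleCosetQuot U α := by
  ext e
  constructor
  · rintro ⟨u, rfl⟩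
    refine ⟨(u : 𝒢) • (α : 𝒢 ⧸ U), ⟨u, rfl⟩, ?_⟩
    change rightTranslateQuot hzn ((u : 𝒢) • (α : 𝒢 ⧸ U)) = (u : 𝒢) • ((α * z : 𝒢) : 𝒢 ⧸ U)
    rw [MulAction.Quotient.smul_coe, MulAction.Quotient.smul_coe, smul_eq_mul, smul_eq_mul, rightTranslateQuot_mk,
      mul_assoc]
  · rintro ⟨d, ⟨u, rfl⟩, rfl⟩
    refine ⟨u, ?_⟩
    change (u : 𝒢) • ((α * z : 𝒢) : 𝒢 ⧸ U) = rightTranslateQuot hzn ((u : 𝒢) • (α : 𝒢 ⧸ U))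
    rw [MulAction.Quotient.smul_coe, MulAction.Quotient.smul_coe, smul_eq_mul, smul_eq_mul, rightTranslateQuot_mk,
      mul_assoc]

open scoped Classical in
/-- **`[U zα U] m = ∑_{d ∈ UαU/U} (z d̃) · m`** on `M^U` (`z` normalising both ways). [folklore] -/
theorem heckeOp_normalizing_mul_apply (hU : U.toSubmonoid ≤ Δ) {z α : 𝒢} (hz : z ∈ Δ) (hα : α ∈ Δ)
    (hzn : ∀ u ∈ U, z⁻¹ * u * z ∈ U) (hzn' : ∀ u ∈ U, z * u * z⁻¹ ∈ U)
    (hfin : (ArithmeticQuotient.doubleCosetQuot U α).Finite) {m : M} (hm : m ∈ invariants Δ θ U) :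
    heckeOp Δ θ U (z * α) m = ∑ d ∈ hfin.toFinset, act Δ θ (z * d.out) m := by
  have hset := doubleCosetQuot_normalizing_mul (U := U) α hzn hzn'
  have hfin' : (ArithmeticQuotient.doubleCosetQuot U (z * α)).Finite := by
    rw [hset]
    exact hfin.image _
  have hmem : ∀ e ∈ ArithmeticQuotient.doubleCosetQuot U (z * α), (z⁻¹ : 𝒢) • e ∈ ArithmeticQuotient.doubleCosetQuot U α := by
    intro e he
    rw [hset] at he
    obtain ⟨d, hd, rfl⟩ := he
    rwa [smul_smul, inv_mul_cancel, one_smul]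
  rw [heckeOp_apply_eq_sum_of_rep hU hfin' hm (fun e => z * ((z⁻¹ : 𝒢) • e).out)
    (fun e he => Δ.mul_mem hz (out_mem_of_mem_doubleCosetQuot hU hα (hmem e he)))
    (fun e he => by
      rw [← smul_eq_mul, ← MulAction.Quotient.smul_coe, QuotientGroup.out_eq', smul_smul, mul_inv_cancel, one_smul])]
  -- reindex `e = z • d`
  refine Finset.sum_nbij' (fun e => (z⁻¹ : 𝒢) • e) (fun d => (z : 𝒢) • d) ?_ ?_ ?_ ?_ fun _ _ => rfl
  · intro e he
    rw [Set.Finite.mem_toFinset] at he ⊢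
    exact hmem e he
  · intro d hd
    rw [Set.Finite.mem_toFinset] at hd ⊢
    rw [hset]
    exact ⟨d, hd, rfl⟩
  · intro e _
    rw [smul_smul, mul_inv_cancel, one_smul]
  · intro d _
    rw [smul_smul, inv_mul_cancel, one_smul]

open scoped Classical in
/-- **`[U αz U] m = ∑_{d ∈ UαU/U} (d̃ z) · m`** on `M^U` (`z` normalising both ways). [folklore] -/
theorem heckeOp_mul_normalizing_apply (hU : U.toSubmonoid ≤ Δ) {z α : 𝒢} (hz : z ∈ Δ) (hα : α ∈ Δ)
    (hzn : ∀ u ∈ U, z⁻¹ * u * z ∈ U) (hzn' : ∀ u ∈ U, z * u * z⁻¹ ∈ U)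
    (hfin : (ArithmeticQuotient.doubleCosetQuot U α).Finite) {m : M} (hm : m ∈ invariants Δ θ U) :
    heckeOp Δ θ U (α * z) m = ∑ d ∈ hfin.toFinset, act Δ θ (d.out * z) m := by
  have hset := doubleCosetQuot_mul_normalizing (U := U) α hzn
  have hfin' : (ArithmeticQuotient.doubleCosetQuot U (α * z)).Finite := by
    rw [hset]
    exact hfin.image _
  have hmem : ∀ e ∈ ArithmeticQuotient.doubleCosetQuot U (α * z),
      rightTranslateQuot (normalizing_inv hzn') e ∈ ArithmeticQuotient.doubleCosetQuot U α := by
    intro e he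
    rw [hset] at he
    obtain ⟨d, hd, rfl⟩ := he
    rwa [rightTranslateQuot_inv_apply hzn hzn']
  rw [heckeOp_apply_eq_sum_of_rep hU hfin' hm (fun e => (rightTranslateQuot (normalizing_inv hzn') e).out * z)
    (fun e he => Δ.mul_mem (out_mem_of_mem_doubleCosetQuot hU hα (hmem e he)) hz)
    (fun e he => by
      rw [← rightTranslateQuot_mk hzn, QuotientGroup.out_eq', rightTranslateQuot_apply_inv hzn hzn'])]
  refine Finset.sum_nbij' (fun e => rightTranslateQuot (normalizing_inv hzn') e) (fun d => rightTranslateQuot hzn d)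
    ?_ ?_ ?_ ?_ fun _ _ => rfl
  · intro e he
    rw [Set.Finite.mem_toFinset] at he ⊢
    exact hmem e he
  · intro d hd
    rw [Set.Finite.mem_toFinset] at hd ⊢
    rw [hset]
    exact ⟨d, hd, rfl⟩
  · intro e _
    rw [rightTranslateQuot_apply_inv hzn hzn']
  · intro d _
    rw [rightTranslateQuot_inv_apply hzn hzn']

open scoped Classical in
/-- **`[U z U] [U α U] = [U α U] [U z U]` on `M^U`** for `z, α ∈ Δ` with `z` normalising `U` (both
ways) and `z α = α z`. [cite: Hida1994AIF, §2] [cite: KhareThorne2017, §6.3] -/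
theorem heckeOp_comm_apply_of_normalizing (hU : U.toSubmonoid ≤ Δ) {z α : 𝒢} (hz : z ∈ Δ) (hα : α ∈ Δ)
    (hzn : ∀ u ∈ U, z⁻¹ * u * z ∈ U) (hzn' : ∀ u ∈ U, z * u * z⁻¹ ∈ U) (hc : z * α = α * z)
    {m : M} (hm : m ∈ invariants Δ θ U) :
    heckeOp Δ θ U z (heckeOp Δ θ U α m) = heckeOp Δ θ U α (heckeOp Δ θ U z m) := by
  by_cases hfin : (ArithmeticQuotient.doubleCosetQuot U α).Finite
  swap
  · rw [heckeOp_eq_zero_of_infinite hfin, LinearMap.zero_apply, LinearMap.zero_apply, map_zero]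
  rw [heckeOp_apply_of_normalizing hU hz hzn (heckeOp_apply_mem hU hα hm),
    heckeOp_apply_of_normalizing hU hz hzn hm, heckeOp_eq_sum hfin, LinearMap.sum_apply,
    LinearMap.sum_apply, map_sum]
  have hL : ∀ d ∈ hfin.toFinset, act Δ θ z (act Δ θ d.out m) = act Δ θ (z * d.out) m := fun d hd => by
    rw [Set.Finite.mem_toFinset] at hd
    rw [act_mul hz (out_mem_of_mem_doubleCosetQuot hU hα hd), Module.End.mul_apply]
  have hR : ∀ d ∈ hfin.toFinset, act Δ θ d.out (act Δ θ z m) = act Δ θ (d.out * z) m := fun d hd => by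
    rw [Set.Finite.mem_toFinset] at hd
    rw [act_mul (out_mem_of_mem_doubleCosetQuot hU hα hd) hz, Module.End.mul_apply]
  rw [Finset.sum_congr rfl hL, Finset.sum_congr rfl hR, ← heckeOp_normalizing_mul_apply hU hz hα hzn hzn' hfin hm,
    ← heckeOp_mul_normalizing_apply hU hz hα hzn hzn' hfin hm, hc]

end Abstract

/-! ### On cohomology and ordinary parts -/

section Cohomology

variable {R : Type u} [CommRing R] {Γ 𝒢 : Type u} [Group Γ] [Group 𝒢] (ι : Γ →* 𝒢) (Δ : Submonoid 𝒢)
  {V : Type u} [AddCommGroup V] [Module R V] (τ : Δ →* Module.End R V) (U : Subgroup 𝒢)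
  (hU : U.toSubmonoid ≤ Δ)

/-- **`[U z U]` and `[U α U]` commute on `H^i(U, τ)`** (`z` normalising both ways, `zα = αz`).
[cite: Hida1994AIF, §2] [cite: KhareThorne2017, §6.3] -/
theorem heckeCohomology_comm_of_normalizing {z α : 𝒢} (hz : z ∈ Δ) (hα : α ∈ Δ)
    (hzn : ∀ u ∈ U, z⁻¹ * u * z ∈ U) (hzn' : ∀ u ∈ U, z * u * z⁻¹ ∈ U) (hc : z * α = α * z) (i : ℕ) :
    heckeCohomology ι Δ τ U hU hz i * heckeCohomology ι Δ τ U hU hα i =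
      heckeCohomology ι Δ τ U hU hα i * heckeCohomology ι Δ τ U hU hz i :=
  heckeCohomology_comm ι τ hU hz hα (fun _ hf => heckeOp_comm_apply_of_normalizing hU hz hα hzn hzn' hc hf) i

/-- **Normalising operators preserve the `[U α U]`-ordinary part** `⋂ₙ range [UαU]ⁿ` (e.g. the
diamond operators preserve the `U_p`-ordinary part). [cite: KhareThorne2017, §6.3] -/
theorem mapsTo_normalizing_ordinaryPart {z α : 𝒢} (hz : z ∈ Δ) (hα : α ∈ Δ)
    (hzn : ∀ u ∈ U, z⁻¹ * u * z ∈ U) (hzn' : ∀ u ∈ U, z * u * z⁻¹ ∈ U) (hc : z * α = α * z) (i : ℕ) :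
    Set.MapsTo (heckeCohomology ι Δ τ U hU hz i)
      (⨅ n : ℕ, LinearMap.range (heckeCohomology ι Δ τ U hU hα i ^ n) : Submodule R (cohomology ι Δ τ U i))
      (⨅ n : ℕ, LinearMap.range (heckeCohomology ι Δ τ U hU hα i ^ n) : Submodule R (cohomology ι Δ τ U i)) := by
  intro x hx
  simp only [SetLike.mem_coe, Submodule.mem_iInf, LinearMap.mem_range] at hx ⊢
  intro n
  obtain ⟨y, hy⟩ := hx n
  refine ⟨heckeCohomology ι Δ τ U hU hz i y, ?_⟩
  have hcomm : Commute (heckeCohomology ι Δ τ U hU hz i) (heckeCohomology ι Δ τ U hU hα i ^ n) :=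
    (show Commute _ _ from heckeCohomology_comm_of_normalizing ι Δ τ U hU hz hα hzn hzn' hc i).pow_right n
  rw [← Module.End.mul_apply, ← hcomm.eq, Module.End.mul_apply, hy]

end Cohomology

end Literature.NumberTheory.Automorphic.LevelAction
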